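import Literature.Topology.FourManifolds.LatticeFormsSylvester
import HarnessLib

/-!
# Diagonal unimodular lattices `s I₊ ⊕ t I₋`: signature and isometry class
(Serre, *A Course in Arithmetic*, Ch. V §1.4.1 and §2.1)

Trunk T-4MAN; companion of `LatticeForms.lean` / `LatticeFormsSylvester.lean`, part of the
decomposition of the named fact `LinearMap.BilinForm.equivalent_of_isIndefinite` (Serre, Ch. V
§2.2 Thm 6). Intrinsic treatment of the lattices `s I₊ ⊕ t I₋`: a lattice `V` with a bilinear form
`Q` *is* (isometric to) `s I₊ ⊕ t I₋` iff it has a `Q`-orthogonal `ℤ`-basis `b` whose squares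
`Q (b i) (b i)` are `±1` (`s` of them `+1`, `t` of them `−1`).

* `isUnit_apply_basis_self_of_isOrthoᵢ`: for a **unimodular** form every orthogonal basis has unit
  squares, so for unimodular lattices "`≅ s I₊ ⊕ t I₋`" is the predicate
  `LinearMap.BilinForm.IsDiagonalizable` of `LatticeForms.lean`.
* `sigPos_eq_card_and_sigNeg_eq_card_of_isOrthoᵢ` (`signature_…`, `finrank_…`): in an orthogonal basis with
  non-zero squares, `b⁺` (resp. `b⁻`) is the number of positive (resp. negative) squares — Serre's
  `r = s + t, τ = s − t` for `s I₊ ⊕ t I₋` (Ch. V §1.4.1), via `card_pos_le_sigPos` and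
  `b⁺ + b⁻ ≤ rank` of `LatticeFormsSylvester.lean`.
* `equivalent_of_isOrthoᵢ_of_sq_eq_one_or`: two lattices with orthogonal bases of unit squares and the
  same rank and signature are isometric ("`s` and `t` are determined by `r` and `τ`", Serre, Ch. V
  §2.1 after Thm 1; this is the bookkeeping step "since `E` and `E'` have the same signature, we
  have `s = s'` and `t = t'`" in the proof of the Corollary to Thm 4, §2.2).
* `sigPos_eq_of_injective_of_smul_mem_range` (+ `sigNeg`, `signature`): an isometric embedding
  `f : V → V'` of lattices with `m V' ⊆ f(V)` for some `m ≠ 0` (a sublattice of finite exponent,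
  e.g. of finite index) preserves `b⁺`, `b⁻` and the signature — the index `τ` is an invariant of
  `E ⊗ ℚ` (Serre, Ch. V §1.3.2); used for the index-2 lattices of Ch. V §3.5 Lemma 6.

All `ℤ`-modules carry the canonical structure `AddCommGroup.toIntModule` (only `[AddCommGroup V]`
is assumed), see the note in `LatticeFormsOrthoSum.lean`.

## Sources

* J.-P. Serre, *A Course in Arithmetic* (GTM 7, Springer 1973), Ch. V §1.3.2 (index), §1.4.1
  (`s I₊ ⊕ t I₋`: `r = s + t`, `τ = s − t`), §2.1 (`s`, `t` determined by `r`, `τ`), §2.2 Cor. to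
  Thm 4. [Serre1973]
* J. Milnor, D. Husemoller, *Symmetric bilinear forms* (Springer 1973), Ch. I §3–§4, Ch. II §2,
  §4. [MilnorHusemoller1973]
-/

open Module
open LinearMap (BilinForm)

namespace LinearMap.BilinForm

variable {V V' : Type*} [AddCommGroup V] [AddCommGroup V']
  {Q : BilinForm ℤ V} {Q' : BilinForm ℤ V'}

/-! ### Orthogonal bases of unimodular lattices have unit squares -/

/-- In an orthogonal basis of a **unimodular** lattice every square `Q (b i) (b i)` is a unit
(`±1`): the coordinate form `b.coord i` is `Q x -` for some `x`, and `1 = Q x (b i) =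
xᵢ · Q (b i) (b i)`. Hence for unimodular lattices an orthogonal basis exhibits `Q ≅ s I₊ ⊕ t I₋`
(Serre, *A Course in Arithmetic*, Ch. V §1.1 (ii): `det = ±1`, with §1.4.1).
[cite: Serre1973, Ch. V §1.1, §1.4.1] -/
theorem isUnit_apply_basis_self_of_isOrthoᵢ (hu : Q.IsUnimodular) {ι : Type*} {b : Basis ι ℤ V}
    (hb : LinearMap.IsOrthoᵢ Q b) (i : ι) : IsUnit (Q (b i) (b i)) := by
  haveI : Q.IsPerfPair := hu
  obtain ⟨x, hx⟩ := (LinearMap.IsPerfPair.bijective_left Q).2 (b.coord i)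
  have h1 : Q x (b i) = 1 := by
    rw [hx]
    simp
  rw [apply_basis_eq_of_isOrthoᵢ hb x i] at h1
  exact IsUnit.of_mul_eq_one_right _ h1

/-- Integer version: in an orthogonal basis of a unimodular lattice, `Q (b i) (b i) = 1` or `= -1`.
Serre, *A Course in Arithmetic*, Ch. V §1.1, §1.4.1. [cite: Serre1973, Ch. V §1.1, §1.4.1] -/
theorem apply_basis_self_eq_one_or_of_isOrthoᵢ (hu : Q.IsUnimodular) {ι : Type*}
    {b : Basis ι ℤ V} (hb : LinearMap.IsOrthoᵢ Q b) (i : ι) :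
    Q (b i) (b i) = 1 ∨ Q (b i) (b i) = -1 :=
  Int.isUnit_iff.mp (isUnit_apply_basis_self_of_isOrthoᵢ hu hb i)

/-! ### Signature in an orthogonal basis -/

/-- Counting: for a family of non-zero elements of a linear order, the positive and the negative
members together exhaust the index type. [folklore] -/
theorem card_pos_add_card_neg {ι α : Type*} [Fintype ι] [LinearOrder α] [Zero α] (f : ι → α)
    (h0 : ∀ i, f i ≠ 0) :
    Fintype.card {i // 0 < f i} + Fintype.card {i // f i < 0} = Fintype.card ι := by
  have e' : {i // f i < 0} ≃ {i // ¬ 0 < f i} :=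
    Equiv.subtypeEquivRight fun i => by
      rw [not_lt]
      exact ⟨le_of_lt, fun h => lt_of_le_of_ne h (h0 i)⟩
  rw [Fintype.card_congr e', Fintype.card_subtype_compl]
  have := Fintype.card_subtype_le fun i => 0 < f i
  omega

/-- **`b⁺` and `b⁻` in an orthogonal basis.** If `b` is a `Q`-orthogonal basis of a lattice with
non-zero squares, then `b⁺(Q)` is the number of `i` with `Q (b i) (b i) > 0` and `b⁻(Q)` the
number with `Q (b i) (b i) < 0` (Serre, *A Course in Arithmetic*, Ch. V §1.4.1: for
`s I₊ ⊕ t I₋`, `r = s + t` and `τ = s − t`; Ch. IV §2.4 over `ℝ`). Proof: the spans give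
`#{>0} ≤ b⁺`, `#{<0} ≤ b⁻` (`card_pos_le_sigPos`), and `b⁺ + b⁻ ≤ rank = #{>0} + #{<0}`.
[cite: Serre1973, Ch. V §1.4.1] -/
theorem sigPos_eq_card_and_sigNeg_eq_card_of_isOrthoᵢ [Module.Finite ℤ V] {ι : Type*} [Fintype ι]
    {b : Basis ι ℤ V} (hb : LinearMap.IsOrthoᵢ Q b) (h0 : ∀ i, Q (b i) (b i) ≠ 0) :
    sigPos Q.toQuadraticMap = Fintype.card {i // 0 < Q (b i) (b i)} ∧
      sigNeg Q.toQuadraticMap = Fintype.card {i // Q (b i) (b i) < 0} := by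
  have horth : Pairwise fun i j => Q (b i) (b j) = 0 := fun i j hij => hb hij
  have hp := card_pos_le_sigPos Q b horth
  have hn := card_pos_le_sigPos (-Q) b fun i j hij => by
    show (-Q) (b i) (b j) = 0
    rw [LinearMap.neg_apply, LinearMap.neg_apply, horth hij, neg_zero]
  rw [show (-Q).toQuadraticMap = -Q.toQuadraticMap from rfl, sigPos_neg] at hn
  have e : {i // 0 < (-Q) (b i) (b i)} ≃ {i // Q (b i) (b i) < 0} :=
    Equiv.subtypeEquivRight fun i => by
      rw [LinearMap.neg_apply, LinearMap.neg_apply, neg_pos]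
  rw [Fintype.card_congr e] at hn
  have hsplit : Fintype.card {i // 0 < Q (b i) (b i)} + Fintype.card {i // Q (b i) (b i) < 0} =
      Fintype.card ι := card_pos_add_card_neg (fun i => Q (b i) (b i)) h0
  have hle := sigPos_add_sigNeg_le_finrank Q.toQuadraticMap
  rw [finrank_eq_card_basis b] at hle
  omega

/-- The signature in an orthogonal basis with non-zero squares: `τ = #{>0} − #{<0}`
(Serre, *A Course in Arithmetic*, Ch. V §1.4.1, `τ(s I₊ ⊕ t I₋) = s − t`).
[cite: Serre1973, Ch. V §1.4.1] -/
theorem signature_eq_card_sub_card_of_isOrthoᵢ [Module.Finite ℤ V] {ι : Type*} [Fintype ι]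
    {b : Basis ι ℤ V} (hb : LinearMap.IsOrthoᵢ Q b) (h0 : ∀ i, Q (b i) (b i) ≠ 0) :
    Q.signature =
      Fintype.card {i // 0 < Q (b i) (b i)} - Fintype.card {i // Q (b i) (b i) < 0} := by
  obtain ⟨h₁, h₂⟩ := sigPos_eq_card_and_sigNeg_eq_card_of_isOrthoᵢ hb h0
  rw [signature, h₁, h₂]

/-- The rank in an orthogonal basis with non-zero squares: `r = #{>0} + #{<0}`
(Serre, *A Course in Arithmetic*, Ch. V §1.4.1, `r(s I₊ ⊕ t I₋) = s + t`).
[cite: Serre1973, Ch. V §1.4.1] -/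
theorem finrank_eq_card_add_card_of_isOrthoᵢ [Module.Finite ℤ V] {ι : Type*} [Fintype ι]
    {b : Basis ι ℤ V} (h0 : ∀ i, Q (b i) (b i) ≠ 0) :
    finrank ℤ V = Fintype.card {i // 0 < Q (b i) (b i)} + Fintype.card {i // Q (b i) (b i) < 0} := by
  rw [card_pos_add_card_neg (fun i => Q (b i) (b i)) h0, finrank_eq_card_basis b]

/-! ### Isometry class of `s I₊ ⊕ t I₋` -/

/-- Relabelling: two families of signs `±1` with the same number of `+1`'s and of `−1`'s differ by
a bijection of the index types. [folklore] -/
theorem exists_equiv_of_card_eq {ι ι' : Type*} [Fintype ι] [Fintype ι'] (f : ι → ℤ) (g : ι' → ℤ)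
    (h₁ : Fintype.card {i // f i = 1} = Fintype.card {i // g i = 1})
    (h : Fintype.card ι = Fintype.card ι') :
    ∃ e : ι ≃ ι', ∀ i, (g (e i) = 1 ↔ f i = 1) := by
  have h₂ : Fintype.card {i // ¬ f i = 1} = Fintype.card {i // ¬ g i = 1} := by
    rw [Fintype.card_subtype_compl, Fintype.card_subtype_compl, h₁, h]
  let e₁ : {i // f i = 1} ≃ {i // g i = 1} := Fintype.equivOfCardEq h₁
  let e₂ : {i // ¬ f i = 1} ≃ {i // ¬ g i = 1} := Fintype.equivOfCardEq h₂
  let toF : ι → ι' := fun i => if hi : f i = 1 then (e₁ ⟨i, hi⟩ : ι') else (e₂ ⟨i, hi⟩ : ι')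
  let invF : ι' → ι := fun j =>
    if hj : g j = 1 then (e₁.symm ⟨j, hj⟩ : ι) else (e₂.symm ⟨j, hj⟩ : ι)
  have ht₁ : ∀ i (hi : f i = 1), toF i = e₁ ⟨i, hi⟩ := fun i hi => dif_pos hi
  have ht₂ : ∀ i (hi : ¬ f i = 1), toF i = e₂ ⟨i, hi⟩ := fun i hi => dif_neg hi
  have hi₁ : ∀ j (hj : g j = 1), invF j = e₁.symm ⟨j, hj⟩ := fun j hj => dif_pos hj
  have hi₂ : ∀ j (hj : ¬ g j = 1), invF j = e₂.symm ⟨j, hj⟩ := fun j hj => dif_neg hj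
  refine ⟨⟨toF, invF, fun i => ?_, fun j => ?_⟩, fun i => ?_⟩
  · by_cases hi : f i = 1
    · rw [ht₁ i hi, hi₁ _ (e₁ ⟨i, hi⟩).2, Subtype.coe_eta, Equiv.symm_apply_apply]
    · rw [ht₂ i hi, hi₂ _ (e₂ ⟨i, hi⟩).2, Subtype.coe_eta, Equiv.symm_apply_apply]
  · by_cases hj : g j = 1
    · rw [hi₁ j hj, ht₁ _ (e₁.symm ⟨j, hj⟩).2, Subtype.coe_eta, Equiv.apply_symm_apply]
    · rw [hi₂ j hj, ht₂ _ (e₂.symm ⟨j, hj⟩).2, Subtype.coe_eta, Equiv.apply_symm_apply]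
  · show g (toF i) = 1 ↔ f i = 1
    by_cases hi : f i = 1
    · rw [ht₁ i hi]
      exact ⟨fun _ => hi, fun _ => (e₁ ⟨i, hi⟩).2⟩
    · rw [ht₂ i hi]
      exact ⟨fun h' => absurd h' (e₂ ⟨i, hi⟩).2, fun h' => absurd h' hi⟩

/-- For a family of signs `±1`, "positive" means "`= 1`". [folklore] -/
theorem card_pos_eq_card_eq_one {ι : Type*} [Fintype ι] (f : ι → ℤ) (hf : ∀ i, f i = 1 ∨ f i = -1) :
    Fintype.card {i // 0 < f i} = Fintype.card {i // f i = 1} :=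
  Fintype.card_congr (Equiv.subtypeEquivRight fun i => by
    rcases hf i with h | h <;> rw [h] <;> decide)

/-- A linear equivalence carrying a `Q`-orthogonal basis to a `Q'`-orthogonal basis with the same
squares is an isometry `Q ≅ Q'` (a bilinear form is determined by its Gram matrix,
Mathlib `LinearMap.BilinForm.ext_basis`). [folklore] -/
theorem equivalent_of_basis_of_equiv {ι ι' : Type*} (b : Basis ι ℤ V) (b' : Basis ι' ℤ V')
    (e : ι ≃ ι') (hb : LinearMap.IsOrthoᵢ Q b) (hb' : LinearMap.IsOrthoᵢ Q' b')
    (he : ∀ i, Q' (b' (e i)) (b' (e i)) = Q (b i) (b i)) : Q.Equivalent Q' := by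
  have key : Q'.comp (b.equiv b' e).toLinearMap (b.equiv b' e).toLinearMap = Q := by
    refine LinearMap.BilinForm.ext_basis b fun i j => ?_
    simp only [comp_apply, LinearEquiv.coe_coe, Basis.equiv_apply]
    by_cases hij : i = j
    · subst hij
      exact he i
    · have h1 : Q' (b' (e i)) (b' (e j)) = 0 := hb' (e.injective.ne hij)
      have h2 : Q (b i) (b j) = 0 := hb hij
      rw [h1, h2]
  exact ⟨{ b.equiv b' e with
    map_app' := fun x y => by
      show Q' (b.equiv b' e x) (b.equiv b' e y) = Q x y
      simpa only [comp_apply, LinearEquiv.coe_coe] using LinearMap.congr_fun₂ key x y }⟩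

/-- **Isometry class of `s I₊ ⊕ t I₋`.** Two lattices admitting orthogonal bases with unit squares
(`±1`) and having the same rank and the same signature are isometric: the number `s` of squares
`+1` and `t` of squares `−1` satisfy `r = s + t`, `τ = s − t`, so "`s` and `t` are determined by
`r` and `τ`" (Serre, *A Course in Arithmetic*, Ch. V §2.1, after Thm 1; used as "since `E` and
`E'` have the same signature, we have `s = s'` and `t = t'`" in §2.2, Cor. to Thm 4), and
relabelling the bases gives the isometry. [cite: Serre1973, Ch. V §2.1–§2.2] -/
theorem equivalent_of_isOrthoᵢ_of_sq_eq_one_or [Module.Finite ℤ V] [Module.Finite ℤ V']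
    {ι ι' : Type*} [Fintype ι] [Fintype ι'] {b : Basis ι ℤ V} {b' : Basis ι' ℤ V'}
    (hb : LinearMap.IsOrthoᵢ Q b) (hb' : LinearMap.IsOrthoᵢ Q' b')
    (hu : ∀ i, Q (b i) (b i) = 1 ∨ Q (b i) (b i) = -1)
    (hu' : ∀ i, Q' (b' i) (b' i) = 1 ∨ Q' (b' i) (b' i) = -1)
    (hrank : finrank ℤ V = finrank ℤ V') (hsig : Q.signature = Q'.signature) :
    Q.Equivalent Q' := by
  have h0 : ∀ i, Q (b i) (b i) ≠ 0 := fun i => by rcases hu i with h | h <;> rw [h] <;> decide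
  have h0' : ∀ i, Q' (b' i) (b' i) ≠ 0 := fun i => by rcases hu' i with h | h <;> rw [h] <;> decide
  have hs := sigPos_eq_card_and_sigNeg_eq_card_of_isOrthoᵢ hb h0
  have hs' := sigPos_eq_card_and_sigNeg_eq_card_of_isOrthoᵢ hb' h0'
  have hr := finrank_eq_card_add_card_of_isOrthoᵢ (Q := Q) (b := b) h0
  have hr' := finrank_eq_card_add_card_of_isOrthoᵢ (Q := Q') (b := b') h0'
  simp only [signature, hs.1, hs.2, hs'.1, hs'.2] at hsig
  have hcard : Fintype.card ι = Fintype.card ι' := by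
    rw [← finrank_eq_card_basis b, ← finrank_eq_card_basis b', hrank]
  have h₁ : Fintype.card {i // Q (b i) (b i) = 1} = Fintype.card {i // Q' (b' i) (b' i) = 1} := by
    rw [← card_pos_eq_card_eq_one (fun i => Q (b i) (b i)) hu,
      ← card_pos_eq_card_eq_one (fun i => Q' (b' i) (b' i)) hu']
    omega
  obtain ⟨e, he⟩ := exists_equiv_of_card_eq (fun i => Q (b i) (b i)) (fun i => Q' (b' i) (b' i))
    h₁ hcard
  refine equivalent_of_basis_of_equiv b b' e hb hb' fun i => ?_
  rcases hu i with h | h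
  · rw [h, (he i).mpr h]
  · rcases hu' (e i) with h' | h'
    · exact absurd ((he i).mp h') (by rw [h]; decide)
    · rw [h, h']

/-! ### Sublattices of finite exponent have the same signature -/

/-- **`b⁺` is unchanged on a sublattice of finite exponent.** Let `f : V → V'` be an injective
linear map of finitely generated `ℤ`-modules, isometric for `Q`, `Q'`, such that `m V' ⊆ f(V)`
for some `m ≠ 0` (`V'` torsion-free). Then `b⁺(Q) = b⁺(Q')`: a positive definite submodule `P`
of `V` maps isomorphically onto one of `V'`, and for a positive definite `P' ≤ V'` the submodule
`m P' ⊆ f(V)` is positive definite of the same rank and pulls back to `V`. (The index is an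
invariant of `E ⊗ ℚ`; Serre, *A Course in Arithmetic*, Ch. V §1.3.2.) [cite: Serre1973, Ch. V §1.3.2] -/
theorem sigPos_eq_of_injective_of_smul_mem_range [Module.Finite ℤ V] [Module.Finite ℤ V']
    [NoZeroSMulDivisors ℤ V'] (f : V →ₗ[ℤ] V') (hf : Function.Injective f)
    (hQ : ∀ x y, Q' (f x) (f y) = Q x y) {m : ℤ} (hm : m ≠ 0)
    (hr : ∀ v', m • v' ∈ LinearMap.range f) :
    sigPos Q.toQuadraticMap = sigPos Q'.toQuadraticMap := by
  refine le_antisymm ?_ ?_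
  · obtain ⟨P, hP, hpos⟩ := exists_finrank_eq_sigPos_and_posDef Q.toQuadraticMap
    rw [← hP, (Submodule.equivMapOfInjective f hf P).finrank_eq]
    refine le_sigPos_of_posDef _ fun x hx => ?_
    obtain ⟨p, hp, hpx⟩ := Submodule.mem_map.mp x.2
    have hp0 : (⟨p, hp⟩ : P) ≠ 0 := by
      intro h
      apply hx
      ext
      rw [← hpx, show p = 0 from congrArg Subtype.val h, map_zero]
      rfl
    have := hpos ⟨p, hp⟩ hp0
    simp only [QuadraticMap.restrict_apply, LinearMap.BilinMap.toQuadraticMap_apply] at this ⊢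
    rwa [← hpx, hQ]
  · obtain ⟨P', hP', hpos'⟩ := exists_finrank_eq_sigPos_and_posDef Q'.toQuadraticMap
    set g : V' →ₗ[ℤ] V' := m • LinearMap.id with hg
    have hginj : Function.Injective g := fun x y hxy => smul_right_injective V' hm hxy
    set P'' : Submodule ℤ V' := P'.map g with hP''
    have hle'' : P'' ≤ LinearMap.range f := by
      rintro _ ⟨x, -, rfl⟩
      exact hr x
    have hsub : P'' ≤ P' := by
      rintro _ ⟨x, hx, rfl⟩
      exact P'.smul_mem m hx
    set P : Submodule ℤ V := P''.comap f with hPdef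
    have hmap : P.map f = P'' := Submodule.map_comap_eq_self hle''
    have hfin : finrank ℤ P = finrank ℤ P' := by
      rw [(Submodule.equivMapOfInjective f hf P).finrank_eq, hmap, hP'',
        ← (Submodule.equivMapOfInjective g hginj P').finrank_eq]
    rw [← hP', ← hfin]
    refine le_sigPos_of_posDef _ fun x hx => ?_
    have hfx : f x ∈ P' := hsub x.2
    have hfx0 : (⟨f x, hfx⟩ : P') ≠ 0 := by
      intro h
      have h' : f x = 0 := congrArg Subtype.val h
      have hx' : (x : V) = 0 := hf (by rw [h', map_zero])
      exact hx (Subtype.ext hx')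
    have := hpos' ⟨f x, hfx⟩ hfx0
    simp only [QuadraticMap.restrict_apply, LinearMap.BilinMap.toQuadraticMap_apply] at this ⊢
    rwa [hQ] at this

/-- `b⁻` is likewise unchanged on a sublattice of finite exponent (apply the previous result to
`-Q`, `-Q'`). Serre, *A Course in Arithmetic*, Ch. V §1.3.2. [cite: Serre1973, Ch. V §1.3.2] -/
theorem sigNeg_eq_of_injective_of_smul_mem_range [Module.Finite ℤ V] [Module.Finite ℤ V']
    [NoZeroSMulDivisors ℤ V'] (f : V →ₗ[ℤ] V') (hf : Function.Injective f)
    (hQ : ∀ x y, Q' (f x) (f y) = Q x y) {m : ℤ} (hm : m ≠ 0)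
    (hr : ∀ v', m • v' ∈ LinearMap.range f) :
    sigNeg Q.toQuadraticMap = sigNeg Q'.toQuadraticMap := by
  rw [← sigPos_neg, ← sigPos_neg, show -Q.toQuadraticMap = (-Q).toQuadraticMap from rfl,
    show -Q'.toQuadraticMap = (-Q').toQuadraticMap from rfl]
  exact sigPos_eq_of_injective_of_smul_mem_range f hf
    (fun x y => by simp only [LinearMap.neg_apply, hQ]) hm hr

/-- **The signature is unchanged on a sublattice of finite exponent** (in particular of finite
index): `τ` is an invariant of `E ⊗ ℚ` (Serre, *A Course in Arithmetic*, Ch. V §1.3.2); used for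
the index-`2` even sublattice `E⁰ ⊂ E` of Ch. V §3.5 Lemma 6. [cite: Serre1973, Ch. V §1.3.2] -/
theorem signature_eq_of_injective_of_smul_mem_range [Module.Finite ℤ V] [Module.Finite ℤ V']
    [NoZeroSMulDivisors ℤ V'] (f : V →ₗ[ℤ] V') (hf : Function.Injective f)
    (hQ : ∀ x y, Q' (f x) (f y) = Q x y) {m : ℤ} (hm : m ≠ 0)
    (hr : ∀ v', m • v' ∈ LinearMap.range f) : Q.signature = Q'.signature := by
  rw [signature, signature, sigPos_eq_of_injective_of_smul_mem_range f hf hQ hm hr,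
    sigNeg_eq_of_injective_of_smul_mem_range f hf hQ hm hr]

end LinearMap.BilinForm
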